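import Summits.CriticalPhenomena.PercolationContinuityZ3.Theorems.PercNearOneGluingNoHeavyLowerTailKnQuestion8CoefficientwiseCoreClassKernelMixBundleBoundary
import HarnessLib

/-!
# Boundary inequality on bundles, XIX: the FILL LEMMA — blue-starting sources are paid by direct fills certified by the other type

Support file (`--supports stmt-CriticalPhenomena-4575`, closed), prover `prim-cplus-coupling` (gen 59).  No definitions, no notations, no named facts,
no sorries; standard axioms.  Memo `prim-cplus-coupling/A5-COUPLING-gen59.md` §2 (THEOREM IET(3)).

SETTING: explicit bundle whose threads are exactly `z, p, q`; up-closed `𝒱`; monotone `{0,1}`-valued `h, k, hᵃ, hᵇ, kᵃ, kᵇ` with `hᵃ ≤ h`, `kᵃ ≤ k`.  A colouring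
is BLUE-STARTING on `z` if `e z 1` is blue and `z` is not all blue.
* `Coefficientwise.bundle_fill_count` — if 𝒱 has a type-1 source and a type-2 source that do NOT start red on `z`, then the sources of 𝒱 (both types) that are
  blue-starting on `z` are at most the supply points `τ` of `𝒱` blue-starting on `z` with `h(X(τ)) = k(X(τ)) = 1`:
  the DIRECT FILL `σ ↦ σ ∪ A x` (`x` = the blue thread of `σ`) is injective and lands in targets — `h(X) = 1` from `X(τ) ⊇ X(σ)`, and `k(X) = 1` because
  `X(τ) ⊇ X(σ′)` for the source `σ′` of the other type not starting red on `z` (a longer red `y`-prefix of `σ′` would make `X(σ) ⊆ X(σ′)`, impossible for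
  sources of different types).  Together with THEOREM CT-COUNT (`…BundleCleanThread`) and the TWO-FREEZE THEOREM (`…BundleTwoFreeze`) this proves
  CONJECTURE IET on every three-thread bundle (`…BundleThreeThreadIET`).
[cite: KozmaNitzan2024, Questions 8–9 (§5.5 p. 36) (context); Harris 1960]
-/

namespace Summit.CriticalPhenomena.PercolationContinuityZ3.Theorems

open Finset Literature.Probability.Percolation

namespace Coefficientwise

variable {ι V : Type*}

open Classical in
/-- **FILL LEMMA (count form; three threads, all 0/1 levels).**  Module docstring.  Memo gen 59 §2.
[cite: KozmaNitzan2024, Questions 8–9 (§5.5 p. 36) (context); Harris 1960] -/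
theorem bundle_fill_count (ends : ι → Sym2 V) (r : ℕ) (L : ℕ → ℕ) (hL : ∀ t, t < r → 1 ≤ L t)
    (w : ℕ → ℕ → V) (e : ℕ → ℕ → ι) (u b : V)
    (hw0 : ∀ t, t < r → w t 0 = u) (hwL : ∀ t, t < r → w t (L t) = b)
    (harc : ∀ t, t < r → ∀ j, 1 ≤ j → j ≤ L t → ends (e t j) = s(w t (j - 1), w t j))
    (hwinj : ∀ t, t < r → ∀ i j, i ≤ L t → j ≤ L t → w t i = w t j → i = j)
    (hcross : ∀ t t', t < r → t' < r → t ≠ t' → ∀ i j, i ≤ L t → j ≤ L t' → w t i = w t' j → (i = 0 ∧ j = 0) ∨ (i = L t ∧ j = L t'))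
    (A : ℕ → Finset ι) (hA : ∀ t, t < r → ∀ i, i ∈ A t ↔ ∃ j, 1 ≤ j ∧ j ≤ L t ∧ e t j = i)
    (hAdisj : ∀ t t', t < r → t' < r → t ≠ t' → Disjoint (A t) (A t'))
    (E : Finset ι) (hEA : ∀ i, i ∈ E ↔ ∃ t, t < r ∧ i ∈ A t)
    (z p q : ℕ) (hz : z < r) (hp : p < r) (hq : q < r) (hzp : z ≠ p) (hzq : z ≠ q) (hpq : p ≠ q)
    (hr3 : ∀ t, t < r → t = z ∨ t = p ∨ t = q)
    (𝒱 : Finset ι → Prop) (hV : ∀ ⦃s t : Finset ι⦄, s ⊆ t → 𝒱 s → 𝒱 t)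
    (h k ha hb ka kb : Set V → ℝ) (mha : Monotone ha) (mka : Monotone ka)
    (h01 : ∀ S, h S = 0 ∨ h S = 1) (k01 : ∀ S, k S = 0 ∨ k S = 1) (ha01 : ∀ S, ha S = 0 ∨ ha S = 1) (ka01 : ∀ S, ka S = 0 ∨ ka S = 1)
    (hah : ∀ S, ha S ≤ h S) (kak : ∀ S, ka S ≤ k S)
    (hA1 : ∃ σ, σ ⊆ E ∧ e z 1 ∉ σ ∧ 𝒱 σ ∧ (b ∈ openCluster (ends '' (↑(E \ σ) : Set ι)) u ∧ b ∉ openCluster (ends '' (↑σ : Set ι)) u) ∧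
        (ha (openCluster (ends '' (↑σ : Set ι)) u) = 1 ∧ hb (openCluster (ends '' (↑(E \ σ) : Set ι)) u) = 0) ∧
        (kb (openCluster (ends '' (↑(E \ σ) : Set ι)) u) = 1 ∧ ka (openCluster (ends '' (↑σ : Set ι)) u) = 0))
    (hA2 : ∃ σ, σ ⊆ E ∧ e z 1 ∉ σ ∧ 𝒱 σ ∧ (b ∈ openCluster (ends '' (↑(E \ σ) : Set ι)) u ∧ b ∉ openCluster (ends '' (↑σ : Set ι)) u) ∧
        (ka (openCluster (ends '' (↑σ : Set ι)) u) = 1 ∧ kb (openCluster (ends '' (↑(E \ σ) : Set ι)) u) = 0) ∧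
        (hb (openCluster (ends '' (↑(E \ σ) : Set ι)) u) = 1 ∧ ha (openCluster (ends '' (↑σ : Set ι)) u) = 0)) :
    ((E.powerset).filter (fun σ => (e z 1 ∉ σ ∧ ¬ Disjoint (A z) σ) ∧ 𝒱 σ ∧
        (b ∈ openCluster (ends '' (↑(E \ σ) : Set ι)) u ∧ b ∉ openCluster (ends '' (↑σ : Set ι)) u) ∧
        (ha (openCluster (ends '' (↑σ : Set ι)) u) = 1 ∧ hb (openCluster (ends '' (↑(E \ σ) : Set ι)) u) = 0) ∧
        (kb (openCluster (ends '' (↑(E \ σ) : Set ι)) u) = 1 ∧ ka (openCluster (ends '' (↑σ : Set ι)) u) = 0))).card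
    + ((E.powerset).filter (fun σ => (e z 1 ∉ σ ∧ ¬ Disjoint (A z) σ) ∧ 𝒱 σ ∧
        (b ∈ openCluster (ends '' (↑(E \ σ) : Set ι)) u ∧ b ∉ openCluster (ends '' (↑σ : Set ι)) u) ∧
        (ka (openCluster (ends '' (↑σ : Set ι)) u) = 1 ∧ kb (openCluster (ends '' (↑(E \ σ) : Set ι)) u) = 0) ∧
        (hb (openCluster (ends '' (↑(E \ σ) : Set ι)) u) = 1 ∧ ha (openCluster (ends '' (↑σ : Set ι)) u) = 0))).card
    ≤ ((E.powerset).filter (fun lam => (e z 1 ∉ lam ∧ ¬ Disjoint (A z) lam) ∧ 𝒱 lam ∧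
        (b ∈ openCluster (ends '' (↑lam : Set ι)) u ∧ b ∉ openCluster (ends '' (↑(E \ lam) : Set ι)) u) ∧
        h (openCluster (ends '' (↑lam : Set ι)) u) = 1 ∧ k (openCluster (ends '' (↑lam : Set ι)) u) = 1)).card := by
  set C : Finset ι → Set V := fun ω => openCluster (ends '' (↑ω : Set ι)) u with hC
  have hr : 0 < r := lt_of_le_of_lt (Nat.zero_le z) hz
  have hAE : ∀ t, t < r → A t ⊆ E := fun t ht i hi => (hEA i).mpr ⟨t, ht, hi⟩
  have heA : ∀ t, t < r → ∀ j, 1 ≤ j → j ≤ L t → e t j ∈ A t := fun t ht j hj1 hjL => (hA t ht _).mpr ⟨j, hj1, hjL, rfl⟩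
  have hE : ∀ i, i ∈ E → ∃ t, t < r ∧ ∃ j, 1 ≤ j ∧ j ≤ L t ∧ e t j = i := fun i hi => by
    obtain ⟨t, ht, hit⟩ := (hEA i).mp hi; exact ⟨t, ht, (hA t ht i).mp hit⟩
  have full_iff : ∀ ω : Finset ι, ω ⊆ E → (b ∈ C ω ↔ ∃ t, t < r ∧ A t ⊆ ω) := fun ω hω =>
    bundle_b_mem_cluster_iff_threads ends r L hL w e u b hr hw0 hwL harc hwinj hcross A hA E hEA ω hω
  have one_of_ge : ∀ (f : Set V → ℝ), (∀ S, f S = 0 ∨ f S = 1) → ∀ S S' : Set V, S ⊆ S' → Monotone f → f S = 1 → f S' = 1 := by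
    intro f f01 S S' hSS' mf h1
    rcases f01 S' with h0 | h0
    · have := mf hSS'; rw [h1, h0] at this; linarith
    · exact h0
  have up1 : ∀ (f g : Set V → ℝ), (∀ S, g S = 0 ∨ g S = 1) → (∀ S, f S ≤ g S) → ∀ S, f S = 1 → g S = 1 := by
    intro f g g01 hfg S e1
    rcases g01 S with h0 | h0
    · have := hfg S; rw [e1, h0] at this; linarith
    · exact h0
  have Cmono : ∀ s t : Finset ι, s ⊆ t → C s ⊆ C t := fun s t hst => openCluster_image_mono ends hst u
  have nofull : ∀ σ : Finset ι, σ ⊆ E → b ∉ C σ → ∀ t, t < r → ∃ j, 1 ≤ j ∧ j ≤ L t ∧ e t j ∉ σ := by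
    intro σ hσ hb' t ht
    by_contra hno
    push Not at hno
    exact hb' ((full_iff σ hσ).mpr ⟨t, ht, fun x hx => by
      obtain ⟨j, hj1, hjL, rfl⟩ := (hA t ht x).mp hx
      exact hno j hj1 hjL⟩)
  have notstart : ∀ (σ : Finset ι) (t : ℕ), t < r → Disjoint (A t) σ → e t 1 ∉ σ :=
    fun σ t ht hd hm => Finset.disjoint_left.mp hd (heA t ht 1 (le_refl 1) (hL t ht)) hm
  -- ## the fill lemma (cluster form): x blue in σ, y the third thread; `fa` the own X-level of σ, zero at σ′
  have core : ∀ (fa : Set V → ℝ), (∀ S, fa S = 0 ∨ fa S = 1) → Monotone fa → ∀ x y : ℕ, x < r → y < r → x ≠ z → y ≠ z → x ≠ y →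
      (∀ t, t < r → t = z ∨ t = x ∨ t = y) → ∀ σ σ' : Finset ι, σ ⊆ E → σ' ⊆ E → Disjoint (A x) σ → e z 1 ∉ σ → b ∉ C σ → fa (C σ) = 1 →
      e z 1 ∉ σ' → b ∉ C σ' → fa (C σ') = 0 → (¬ Disjoint (A y) σ) ∧ C σ' ⊆ C (σ ∪ A x) := by
    intro fa fa01 mfa x y hx hy hxz hyz hxy hr3' σ σ' hσ hσ' hdx hz1 hbσ h1 hz1' hbσ' h0
    -- the cluster of σ consists of u and y-prefix vertices
    have clσ : ∀ v, v ∈ C σ → v = u ∨ ∃ j, 1 ≤ j ∧ j < L y ∧ v = w y j ∧ ∀ j', 1 ≤ j' → j' ≤ j → e y j' ∈ σ := by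
      intro v hv
      rcases bundle_cluster_subset_prefix ends r L w e u hw0 harc hwinj hcross E hE σ hσ (nofull σ hσ hbσ) hv with h0' | ⟨t, ht, j, hj1, hjL, hv', hrun⟩
      · exact Or.inl h0'
      · rcases hr3' t ht with rfl | rfl | rfl
        · exact absurd (hrun 1 (le_refl 1) hj1) hz1
        · exact absurd (hrun 1 (le_refl 1) hj1) (notstart σ t ht hdx)
        · exact Or.inr ⟨j, hj1, hjL, hv', hrun⟩
    -- if σ had no red y-edge below some missing position, its cluster would sit inside the cluster of σ′
    have absorb : ∀ j₁, 1 ≤ j₁ → j₁ ≤ L y → e y j₁ ∉ σ → (∀ j', 1 ≤ j' → j' < j₁ → e y j' ∈ σ') → False := by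
      intro j₁ hj₁1 hj₁L hj₁ hrun'
      have hsub : C σ ⊆ C σ' := by
        intro v hv
        rcases clσ v hv with rfl | ⟨j, hj1, hjL, rfl, hrun⟩
        · exact mem_openCluster_self _ _
        · have hjlt : j < j₁ := by
            by_contra hle
            exact hj₁ (hrun j₁ hj₁1 (by omega))
          exact bundle_prefix_mem_cluster ends r L w e u hw0 harc σ' y hy j (le_of_lt hjL) fun j' h1' h2' => hrun' j' h1' (by omega)
      have := one_of_ge fa fa01 _ _ hsub mfa h1
      rw [h0] at this; exact one_ne_zero this.symm
    refine ⟨fun hdy => absorb 1 (le_refl 1) (hL y hy) (notstart σ y hy hdy) (fun j' h1' h2' => by omega), ?_⟩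
    intro v hv
    rcases bundle_cluster_subset_prefix ends r L w e u hw0 harc hwinj hcross E hE σ' hσ' (nofull σ' hσ' hbσ') hv with h0' | ⟨t, ht, j, hj1, hjL, rfl, hrun⟩
    · rw [h0']; exact mem_openCluster_self _ _
    · rcases hr3' t ht with rfl | rfl | rfl
      · exact absurd (hrun 1 (le_refl 1) hj1) hz1'
      · exact bundle_prefix_mem_cluster ends r L w e u hw0 harc (σ ∪ A t) t ht j (le_of_lt hjL)
          fun j' h1' h2' => Finset.mem_union_right _ (heA t ht j' h1' (by omega))
      · -- the red y-prefix of σ′ lies in σ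
        have hin : ∀ j', 1 ≤ j' → j' ≤ j → e t j' ∈ σ := by
          intro j' h1' h2'
          by_contra hn
          -- take the first missing position
          have hex : ∃ j₁, 1 ≤ j₁ ∧ j₁ ≤ L t ∧ e t j₁ ∉ σ := ⟨j', h1', by omega, hn⟩
          obtain ⟨hm1, hmL, hmσ⟩ := Nat.find_spec hex
          have hmin : ∀ i, i < Nat.find hex → 1 ≤ i → i ≤ L t → e t i ∈ σ := by
            intro i hi hi1 hiL; by_contra hni; exact Nat.find_min hex hi ⟨hi1, hiL, hni⟩
          have hle : Nat.find hex ≤ j' := Nat.find_min' hex ⟨h1', by omega, hn⟩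
          exact absorb (Nat.find hex) hm1 hmL hmσ fun i h1'' h2'' => hrun i h1'' (by omega)
        exact bundle_prefix_mem_cluster ends r L w e u hw0 harc (σ ∪ A x) t ht j (le_of_lt hjL)
          fun j' h1' h2' => Finset.mem_union_left _ (hin j' h1' h2')
  -- ## the fill is a blue-starting target
  obtain ⟨σ₁, hσ₁E, hz₁, -, hN₁, hs₁h, hs₁k⟩ := hA1
  obtain ⟨σ₂, hσ₂E, hz₂, -, hN₂, hs₂k, hs₂h⟩ := hA2
  have hr3x : ∀ x y : ℕ, (x = p ∧ y = q) ∨ (x = q ∧ y = p) → ∀ t, t < r → t = z ∨ t = x ∨ t = y := by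
    rintro x y (⟨rfl, rfl⟩ | ⟨rfl, rfl⟩) t ht
    · exact hr3 t ht
    · exact (hr3 t ht).elim Or.inl fun h => h.elim (fun h => Or.inr (Or.inr h)) fun h => Or.inr (Or.inl h)
  have fill : ∀ x y : ℕ, (x = p ∧ y = q) ∨ (x = q ∧ y = p) → ∀ σ : Finset ι, σ ⊆ E → Disjoint (A x) σ →
      ((e z 1 ∉ σ ∧ ¬ Disjoint (A z) σ) ∧ 𝒱 σ ∧ (b ∈ C (E \ σ) ∧ b ∉ C σ) ∧
        ((ha (C σ) = 1 ∧ hb (C (E \ σ)) = 0) ∧ (kb (C (E \ σ)) = 1 ∧ ka (C σ) = 0) ∨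
         (ka (C σ) = 1 ∧ kb (C (E \ σ)) = 0) ∧ (hb (C (E \ σ)) = 1 ∧ ha (C σ) = 0))) →
      (σ ∪ A x ⊆ E ∧ ((e z 1 ∉ σ ∪ A x ∧ ¬ Disjoint (A z) (σ ∪ A x)) ∧ 𝒱 (σ ∪ A x) ∧ (b ∈ C (σ ∪ A x) ∧ b ∉ C (E \ (σ ∪ A x))) ∧
        h (C (σ ∪ A x)) = 1 ∧ k (C (σ ∪ A x)) = 1)) ∧ ¬ A y ⊆ σ ∪ A x := by
    intro x y hxy σ hσ hdx hs
    have hx : x < r := by rcases hxy with ⟨rfl, -⟩ | ⟨rfl, -⟩ <;> assumption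
    have hy : y < r := by rcases hxy with ⟨-, rfl⟩ | ⟨-, rfl⟩ <;> assumption
    have hxz : x ≠ z := by rcases hxy with ⟨rfl, -⟩ | ⟨rfl, -⟩; exacts [hzp.symm, hzq.symm]
    have hyz : y ≠ z := by rcases hxy with ⟨-, rfl⟩ | ⟨-, rfl⟩; exacts [hzq.symm, hzp.symm]
    have hxy' : x ≠ y := by rcases hxy with ⟨rfl, rfl⟩ | ⟨rfl, rfl⟩; exacts [hpq, hpq.symm]
    obtain ⟨⟨hz1, hndz⟩, hv, hN, hst⟩ := hs
    have hτE : σ ∪ A x ⊆ E := Finset.union_subset hσ (hAE x hx)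
    -- y is red somewhere in σ and the other type's source sits inside the fill's cluster
    have main : (¬ Disjoint (A y) σ) ∧ h (C (σ ∪ A x)) = 1 ∧ k (C (σ ∪ A x)) = 1 := by
      rcases hst with ⟨⟨hha, -⟩, -, hka⟩ | ⟨⟨hka, -⟩, -, hha⟩
      · obtain ⟨hndy, hsub⟩ := core ha ha01 mha x y hx hy hxz hyz hxy' (hr3x x y hxy) σ σ₂ hσ hσ₂E hdx hz1 hN.2 hha hz₂ hN₂.2 hs₂h.2
        exact ⟨hndy, up1 ha h h01 hah _ (one_of_ge ha ha01 _ _ (Cmono _ _ Finset.subset_union_left) mha hha),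
          up1 ka k k01 kak _ (one_of_ge ka ka01 _ _ hsub mka hs₂k.1)⟩
      · obtain ⟨hndy, hsub⟩ := core ka ka01 mka x y hx hy hxz hyz hxy' (hr3x x y hxy) σ σ₁ hσ hσ₁E hdx hz1 hN.2 hka hz₁ hN₁.2 hs₁k.2
        exact ⟨hndy, up1 ha h h01 hah _ (one_of_ge ha ha01 _ _ hsub mha hs₁h.1),
          up1 ka k k01 kak _ (one_of_ge ka ka01 _ _ (Cmono _ _ Finset.subset_union_left) mka hka)⟩
    obtain ⟨hndy, hh1, hk1⟩ := main
    have hzx : e z 1 ∉ σ ∪ A x := by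
      intro hm
      rcases Finset.mem_union.mp hm with h' | h'
      · exact hz1 h'
      · exact Finset.disjoint_left.mp (hAdisj z x hz hx hxz.symm) (heA z hz 1 (le_refl 1) (hL z hz)) h'
    have hbX : b ∈ C (σ ∪ A x) := (full_iff _ hτE).mpr ⟨x, hx, Finset.subset_union_right⟩
    have hbY : b ∉ C (E \ (σ ∪ A x)) := by
      intro hbm
      obtain ⟨t, ht, hsub⟩ := (full_iff (E \ (σ ∪ A x)) Finset.sdiff_subset).mp hbm
      have hdt : Disjoint (A t) (σ ∪ A x) := Finset.disjoint_left.mpr fun i hi him => (Finset.mem_sdiff.mp (hsub hi)).2 him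
      rcases hr3x x y hxy t ht with rfl | rfl | rfl
      · exact hndz (Finset.disjoint_of_subset_right Finset.subset_union_left hdt)
      · exact Finset.disjoint_left.mp hdt (heA t ht 1 (le_refl 1) (hL t ht)) (Finset.mem_union_right _ (heA t ht 1 (le_refl 1) (hL t ht)))
      · exact hndy (Finset.disjoint_of_subset_right Finset.subset_union_left hdt)
    refine ⟨⟨hτE, ⟨hzx, fun hd => hndz (Finset.disjoint_of_subset_right Finset.subset_union_left hd)⟩, hV Finset.subset_union_left hv, ⟨hbX, hbY⟩, hh1, hk1⟩, ?_⟩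
    -- y is not full in the fill (σ has no full thread)
    intro hyfull
    obtain ⟨j, hj1, hjL, hj⟩ := nofull σ hσ hN.2 y hy
    rcases Finset.mem_union.mp (hyfull (heA y hy j hj1 hjL)) with h' | h'
    · exact hj h'
    · exact Finset.disjoint_left.mp (hAdisj y x hy hx hxy'.symm) (heA y hy j hj1 hjL) h'
  -- ## counting: split the sources by their blue face and fill it
  set Src : Finset (Finset ι) := (E.powerset).filter (fun σ => (e z 1 ∉ σ ∧ ¬ Disjoint (A z) σ) ∧ 𝒱 σ ∧ (b ∈ C (E \ σ) ∧ b ∉ C σ) ∧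
      ((ha (C σ) = 1 ∧ hb (C (E \ σ)) = 0) ∧ (kb (C (E \ σ)) = 1 ∧ ka (C σ) = 0) ∨
       (ka (C σ) = 1 ∧ kb (C (E \ σ)) = 0) ∧ (hb (C (E \ σ)) = 1 ∧ ha (C σ) = 0))) with hSrc
  set Tgt : Finset (Finset ι) := (E.powerset).filter (fun lam => (e z 1 ∉ lam ∧ ¬ Disjoint (A z) lam) ∧ 𝒱 lam ∧ (b ∈ C lam ∧ b ∉ C (E \ lam)) ∧
      h (C lam) = 1 ∧ k (C lam) = 1) with hTgt
  -- a source of the split set has p or q blue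
  have face : ∀ σ, σ ∈ Src → Disjoint (A p) σ ∨ Disjoint (A q) σ := by
    intro σ hσ
    rw [hSrc, Finset.mem_filter, Finset.mem_powerset] at hσ
    obtain ⟨hσE, ⟨-, hndz⟩, -, hN, -⟩ := hσ
    obtain ⟨t, ht, hsub⟩ := (full_iff (E \ σ) Finset.sdiff_subset).mp hN.1
    have hd : Disjoint (A t) σ := Finset.disjoint_left.mpr fun x hx hxσ => (Finset.mem_sdiff.mp (hsub hx)).2 hxσ
    rcases hr3 t ht with rfl | rfl | rfl
    · exact absurd hd hndz
    · exact Or.inl hd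
    · exact Or.inr hd
  have cntP : (Src.filter (fun σ => Disjoint (A p) σ)).card ≤ (Tgt.filter (fun lam => A p ⊆ lam)).card := by
    refine Finset.card_le_card_of_injOn (fun σ => σ ∪ A p) (fun σ hσ => ?_) ?_
    · rw [Finset.mem_coe, Finset.mem_filter] at hσ
      obtain ⟨hσS, hdp⟩ := hσ
      rw [hSrc, Finset.mem_filter, Finset.mem_powerset] at hσS
      obtain ⟨⟨hτE, hτ⟩, -⟩ := fill p q (Or.inl ⟨rfl, rfl⟩) σ hσS.1 hdp hσS.2
      rw [Finset.mem_coe, Finset.mem_filter, hTgt, Finset.mem_filter, Finset.mem_powerset]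
      exact ⟨⟨hτE, hτ⟩, Finset.subset_union_right⟩
    · intro σ hσ σ' hσ' heq
      rw [Finset.mem_coe, Finset.mem_filter] at hσ hσ'
      have e1 : (σ ∪ A p) \ A p = σ := by rw [Finset.union_sdiff_right, Finset.sdiff_eq_self_of_disjoint hσ.2.symm]
      have e2 : (σ' ∪ A p) \ A p = σ' := by rw [Finset.union_sdiff_right, Finset.sdiff_eq_self_of_disjoint hσ'.2.symm]
      have := congrArg (fun s => s \ A p) heq
      simp only [e1, e2] at this
      exact this
  have cntQ : (Src.filter (fun σ => ¬ Disjoint (A p) σ)).card ≤ (Tgt.filter (fun lam => ¬ A p ⊆ lam)).card := by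
    refine Finset.card_le_card_of_injOn (fun σ => σ ∪ A q) (fun σ hσ => ?_) ?_
    · rw [Finset.mem_coe, Finset.mem_filter] at hσ
      obtain ⟨hσS, hndp⟩ := hσ
      have hdq : Disjoint (A q) σ := (face σ hσS).resolve_left hndp
      rw [hSrc, Finset.mem_filter, Finset.mem_powerset] at hσS
      obtain ⟨⟨hτE, hτ⟩, hnp⟩ := fill q p (Or.inr ⟨rfl, rfl⟩) σ hσS.1 hdq hσS.2
      rw [Finset.mem_coe, Finset.mem_filter, hTgt, Finset.mem_filter, Finset.mem_powerset]
      exact ⟨⟨hτE, hτ⟩, hnp⟩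
    · intro σ hσ σ' hσ' heq
      rw [Finset.mem_coe, Finset.mem_filter] at hσ hσ'
      have hdq : Disjoint (A q) σ := (face σ hσ.1).resolve_left hσ.2
      have hdq' : Disjoint (A q) σ' := (face σ' hσ'.1).resolve_left hσ'.2
      have e1 : (σ ∪ A q) \ A q = σ := by rw [Finset.union_sdiff_right, Finset.sdiff_eq_self_of_disjoint hdq.symm]
      have e2 : (σ' ∪ A q) \ A q = σ' := by rw [Finset.union_sdiff_right, Finset.sdiff_eq_self_of_disjoint hdq'.symm]
      have := congrArg (fun s => s \ A q) heq
      simp only [e1, e2] at this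
      exact this
  have splitS := Finset.card_filter_add_card_filter_not (s := Src) (fun σ => Disjoint (A p) σ)
  have splitT := Finset.card_filter_add_card_filter_not (s := Tgt) (fun lam => A p ⊆ lam)
  -- the two type filters are disjoint parts of Src
  have hunion : (E.powerset).filter (fun σ => (e z 1 ∉ σ ∧ ¬ Disjoint (A z) σ) ∧ 𝒱 σ ∧ (b ∈ C (E \ σ) ∧ b ∉ C σ) ∧
        (ha (C σ) = 1 ∧ hb (C (E \ σ)) = 0) ∧ (kb (C (E \ σ)) = 1 ∧ ka (C σ) = 0)) ∪
      (E.powerset).filter (fun σ => (e z 1 ∉ σ ∧ ¬ Disjoint (A z) σ) ∧ 𝒱 σ ∧ (b ∈ C (E \ σ) ∧ b ∉ C σ) ∧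
        (ka (C σ) = 1 ∧ kb (C (E \ σ)) = 0) ∧ (hb (C (E \ σ)) = 1 ∧ ha (C σ) = 0)) = Src := by
    ext σ
    rw [Finset.mem_union, hSrc, Finset.mem_filter, Finset.mem_filter, Finset.mem_filter]
    constructor
    · rintro (⟨hE', hB, hv, hN, ht⟩ | ⟨hE', hB, hv, hN, ht⟩)
      · exact ⟨hE', hB, hv, hN, Or.inl ht⟩
      · exact ⟨hE', hB, hv, hN, Or.inr ht⟩
    · rintro ⟨hE', hB, hv, hN, ht | ht⟩
      · exact Or.inl ⟨hE', hB, hv, hN, ht⟩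
      · exact Or.inr ⟨hE', hB, hv, hN, ht⟩
  have hdisj : Disjoint ((E.powerset).filter (fun σ => (e z 1 ∉ σ ∧ ¬ Disjoint (A z) σ) ∧ 𝒱 σ ∧ (b ∈ C (E \ σ) ∧ b ∉ C σ) ∧
        (ha (C σ) = 1 ∧ hb (C (E \ σ)) = 0) ∧ (kb (C (E \ σ)) = 1 ∧ ka (C σ) = 0)))
      ((E.powerset).filter (fun σ => (e z 1 ∉ σ ∧ ¬ Disjoint (A z) σ) ∧ 𝒱 σ ∧ (b ∈ C (E \ σ) ∧ b ∉ C σ) ∧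
        (ka (C σ) = 1 ∧ kb (C (E \ σ)) = 0) ∧ (hb (C (E \ σ)) = 1 ∧ ha (C σ) = 0))) := by
    rw [Finset.disjoint_filter]
    intro σ _ h1 h2
    have e1 := h1.2.2.2.1.1
    rw [h2.2.2.2.2.2] at e1
    exact one_ne_zero e1.symm
  have src12 := Finset.card_union_of_disjoint hdisj
  rw [hunion] at src12
  have fin : ((E.powerset).filter (fun σ => (e z 1 ∉ σ ∧ ¬ Disjoint (A z) σ) ∧ 𝒱 σ ∧ (b ∈ C (E \ σ) ∧ b ∉ C σ) ∧
        (ha (C σ) = 1 ∧ hb (C (E \ σ)) = 0) ∧ (kb (C (E \ σ)) = 1 ∧ ka (C σ) = 0))).card +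
      ((E.powerset).filter (fun σ => (e z 1 ∉ σ ∧ ¬ Disjoint (A z) σ) ∧ 𝒱 σ ∧ (b ∈ C (E \ σ) ∧ b ∉ C σ) ∧
        (ka (C σ) = 1 ∧ kb (C (E \ σ)) = 0) ∧ (hb (C (E \ σ)) = 1 ∧ ha (C σ) = 0))).card ≤ Tgt.card := by
    omega
  convert fin using 2

end Coefficientwise

end Summit.CriticalPhenomena.PercolationContinuityZ3.Theorems
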